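import Mathlib.Analysis.MeanInequalities
import Mathlib.MeasureTheory.Function.L2Space
import Mathlib.MeasureTheory.Integral.Bochner.Basic
import Literature.Analysis.FunctionSpaces.TorusVectorParseval
import Literature.Analysis.FunctionSpaces.TorusFourierCalculus
import Literature.Analysis.FluidPDE.ZerothLaw
import Literature.Analysis.FluidPDE.LongTimeAverageNonneg
import HarnessLib

/-!
# The Alexakis–Doering interpolation step `ε² ≤ ν U² χ`, proved under explicit regularity

Alexakis–Doering, *Energy and enstrophy dissipation in steady state 2d turbulence*, Phys. Lett.
A 359 (2006), §2, display "(trickI)": "we use integrations by parts and the Cauchy–Schwarz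
inequality to see that `⟨ω²⟩² = ⟨u·∇×(k̂ω)⟩² ≤ ⟨|u|²⟩⟨|∇ω|²⟩`", i.e. `ε² ≤ ν U² χ` for
`ε = ν⟨‖∇u‖²⟩`, `U² = ⟨‖u‖²⟩`, `χ = ν⟨‖Δu‖²⟩`. This file proves the inequality for the tree's
renderings (`Turb.meanDissipation`, `Turb.rmsVelocity longTimeAvgSup`,
`Turb.meanEnstrophyDissipation`: spectral norms, `limsup` of running time means) for an
*arbitrary* time-dependent field `u : ℝ → T^d → ℝ^d` in any dimension, under exactly the
regularity that keeps the three averages honest: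

1. **space** (`eGradNormSq_sq_le_lintegral_mul_eLaplacianNormSq`): for `v ∈ L²`,
   `‖∇v‖₂⁴ ≤ ‖v‖₂² ‖Δv‖₂²` in `[0, ∞]` — in Fourier variables the Cauchy–Schwarz inequality
   `(∑|k|²|v̂_k|²)² ≤ (∑|v̂_k|²)(∑|k|⁴|v̂_k|²)` (`sq_tsum_mul_le_tsum_mul_tsum`) and Parseval
   (`Torus.tsum_enorm_sq_mFourierCoeff_complexify`);
2. **time** (`timeMean_le_sqrt_timeMean_mul_timeMean`): Cauchy–Schwarz for the running means,
   `T⁻¹∫₀ᵀ G ≤ (T⁻¹∫₀ᵀ E)^{1/2} (T⁻¹∫₀ᵀ L)^{1/2}` when `G² ≤ E L` a.e., `E, L` integrable;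
3. **limsup** (`limsup_le_sqrt_of_eventually_le`): passing to `limsup_{T→∞}` when the running
   means of `E` and `L` are eventually bounded (otherwise the real `limsup` is the junk value
   `sInf ∅ = 0` and the inequality may fail);
4. **assembly** (`meanDissipation_sq_le_of_regular`): `ε² ≤ ν U² χ` for every `ν ≥ 0` and
   every `u` with `u(t) ∈ L² ∩ H²` for a.e. `t > 0`, `t ↦ ‖∇u(t)‖₂²` measurable,
   `t ↦ ‖u(t)‖₂², ‖Δu(t)‖₂²` locally integrable on `[0, ∞)`, and eventually bounded running
   means of `‖u‖₂²` and `‖Δu‖₂²`. For 2-D Leray–Hopf solutions with smooth data these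
   hypotheses are the output of the 2-D regularity theory (Kuksin–Shirikyan 2012, Thm. 2.1.19)
   and of the enstrophy balance; feeding them in is the job of the named fact
   `Literature.Analysis.FluidPDE.AlexakisDoering2006_dissipation_sq_le` (`AlexakisDoering`).

Also: `isBoundedUnder_timeMean_of_longTimeAvgSup_ne_zero` — a nonzero `limsup` average forces
eventually bounded running means (the hypothesis `0 < U` of the turbulence statements thus
makes `U` honest).

## Mathlib search

Used: `ENNReal.inner_le_Lp_mul_Lq` (Hölder for finite sums in `ℝ≥0∞`), `ENNReal.tsum_eq_iSup_sum`,
`integral_mul_le_Lp_mul_Lq_of_nonneg` (Hölder for real integrals), `memLp_two_iff_integrable_sq`,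
`Filter.eventually_lt_of_limsup_lt`, `Filter.limsup_le_of_le`. Mathlib has no `tsum` Hölder in
`ℝ≥0∞` (only `NNReal.inner_le_Lp_mul_Lq_tsum` with summability hypotheses) and no product rule
for real `limsup`s; both are proved here in the form needed.

## References

* A. Alexakis, C. R. Doering, Phys. Lett. A 359 (2006), §2, display (trickI)
  (arXiv:physics/0605090). [AlexakisDoering2006PLA]
-/

open MeasureTheory Filter Set UnitAddTorus
open scoped ENNReal NNReal Topology

noncomputable section

namespace Literature.Analysis.FluidPDE

open Literature.Analysis.FunctionSpaces

/-! ### Cauchy–Schwarz for `ℝ≥0∞`-valued series -/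

section CauchySchwarz

variable {ι : Type*}

/-- Cauchy–Schwarz for `ℝ≥0∞`-valued series: `∑ fᵢgᵢ ≤ (∑ fᵢ²)^{1/2} (∑ gᵢ²)^{1/2}`, with no
summability hypotheses (finite Hölder `ENNReal.inner_le_Lp_mul_Lq` on every finite set, then
`iSup`). [folklore] -/
theorem tsum_mul_le_sqrt_mul_sqrt (f g : ι → ℝ≥0∞) :
    ∑' i, f i * g i ≤ (∑' i, f i ^ 2) ^ (1 / 2 : ℝ) * (∑' i, g i ^ 2) ^ (1 / 2 : ℝ) := by
  rw [ENNReal.tsum_eq_iSup_sum]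
  refine iSup_le fun s => ?_
  have h := ENNReal.inner_le_Lp_mul_Lq (s := s) f g Real.HolderConjugate.two_two
  have hf : (∑ i ∈ s, f i ^ (2 : ℝ)) ≤ ∑' i, f i ^ 2 := by
    simp only [ENNReal.rpow_two]
    exact ENNReal.sum_le_tsum s
  have hg : (∑ i ∈ s, g i ^ (2 : ℝ)) ≤ ∑' i, g i ^ 2 := by
    simp only [ENNReal.rpow_two]
    exact ENNReal.sum_le_tsum s
  calc ∑ i ∈ s, f i * g i
      ≤ (∑ i ∈ s, f i ^ (2 : ℝ)) ^ (1 / (2 : ℝ)) * (∑ i ∈ s, g i ^ (2 : ℝ)) ^ (1 / (2 : ℝ)) := h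
    _ ≤ (∑' i, f i ^ 2) ^ (1 / 2 : ℝ) * (∑' i, g i ^ 2) ^ (1 / 2 : ℝ) := by
        gcongr

/-- Weighted Cauchy–Schwarz for `ℝ≥0∞`-valued series in squared form:
`(∑ wᵢ aᵢ)² ≤ (∑ aᵢ)(∑ wᵢ² aᵢ)` (apply `tsum_mul_le_sqrt_mul_sqrt` to `aᵢ^{1/2}` and
`wᵢ aᵢ^{1/2}`). This is the Fourier-side form of `‖∇v‖₂⁴ ≤ ‖v‖₂²‖Δv‖₂²` with `aₖ = |v̂ₖ|²`,
`wₖ = |k|²`. [folklore] -/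
theorem sq_tsum_mul_le_tsum_mul_tsum (w a : ι → ℝ≥0∞) :
    (∑' i, w i * a i) ^ 2 ≤ (∑' i, a i) * ∑' i, w i ^ 2 * a i := by
  have h := tsum_mul_le_sqrt_mul_sqrt (fun i => a i ^ (1 / 2 : ℝ))
    (fun i => w i * a i ^ (1 / 2 : ℝ))
  have e1 : ∀ i, a i ^ (1 / 2 : ℝ) * (w i * a i ^ (1 / 2 : ℝ)) = w i * a i := fun i => by
    rw [mul_left_comm, ← sq, ENNReal.rpow_half_sq]
  have e2 : ∀ i, (a i ^ (1 / 2 : ℝ)) ^ 2 = a i := fun i => ENNReal.rpow_half_sq _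
  have e3 : ∀ i, (w i * a i ^ (1 / 2 : ℝ)) ^ 2 = w i ^ 2 * a i := fun i => by
    rw [mul_pow, ENNReal.rpow_half_sq]
  simp only [e1, e2, e3] at h
  calc (∑' i, w i * a i) ^ 2
      ≤ ((∑' i, a i) ^ (1 / 2 : ℝ) * (∑' i, w i ^ 2 * a i) ^ (1 / 2 : ℝ)) ^ 2 := by
        gcongr
    _ = (∑' i, a i) * ∑' i, w i ^ 2 * a i := by
        rw [mul_pow, ENNReal.rpow_half_sq, ENNReal.rpow_half_sq]

end CauchySchwarz

/-! ### Space: `‖∇v‖₂⁴ ≤ ‖v‖₂² ‖Δv‖₂²` spectrally -/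

section Space

variable {d : Type*} [Fintype d]

/-- The squared homogeneous `Ḣ¹` seminorm as a weighted series:
`|f|²_{Ḣ¹} = ∑ₖ wₖ |f̂ₖ|²` with `wₖ = |k|²` off `k = 0` (unfolding; `|k|^{2·1} = |k|²`). [folklore] -/
theorem eHomSobolevSeminorm_one_sq_eq_tsum {F : Type*} [NormedAddCommGroup F] [NormedSpace ℂ F]
    (f : UnitAddTorus d → F) :
    Torus.eHomSobolevSeminorm 1 f ^ 2 =
      ∑' k : d → ℤ, (if k = 0 then 0 else ENNReal.ofReal (Torus.freqNormSq k)) *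
        ‖mFourierCoeff f k‖ₑ ^ 2 := by
  rw [Torus.eHomSobolevSeminorm, ENNReal.rpow_half_sq]
  refine tsum_congr fun k => ?_
  by_cases hk : k = 0
  · simp [hk]
  · rw [if_neg hk, if_neg hk, Real.rpow_one]

/-- The squared homogeneous `Ḣ²` seminorm as a weighted series with the *squared* `Ḣ¹` weights:
`|f|²_{Ḣ²} = ∑ₖ wₖ² |f̂ₖ|²`, `wₖ = |k|²` off `k = 0` (unfolding; `|k|^{2·2} = (|k|²)²`). [folklore] -/
theorem eHomSobolevSeminorm_two_sq_eq_tsum {F : Type*} [NormedAddCommGroup F] [NormedSpace ℂ F]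
    (f : UnitAddTorus d → F) :
    Torus.eHomSobolevSeminorm 2 f ^ 2 =
      ∑' k : d → ℤ, (if k = 0 then 0 else ENNReal.ofReal (Torus.freqNormSq k)) ^ 2 *
        ‖mFourierCoeff f k‖ₑ ^ 2 := by
  rw [Torus.eHomSobolevSeminorm, ENNReal.rpow_half_sq]
  refine tsum_congr fun k => ?_
  by_cases hk : k = 0
  · simp [hk]
  · rw [if_neg hk, if_neg hk, Real.rpow_two, ENNReal.ofReal_pow (Torus.freqNormSq_nonneg k)]

/-- `∫⁻ ‖v‖ₑ² = ofReal ∫ ‖v‖²` for `v ∈ L²(T^d; ℝ^d)`. [folklore] -/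
theorem lintegral_enorm_sq_eq_ofReal {v : UnitAddTorus d → EuclideanSpace ℝ d}
    (hv : MemLp v 2 volume) : ∫⁻ x, ‖v x‖ₑ ^ 2 = ENNReal.ofReal (∫ x, ‖v x‖ ^ 2) := by
  rw [ofReal_integral_eq_lintegral_ofReal (hv.integrable_norm_pow two_ne_zero)
    (ae_of_all _ fun x => by positivity)]
  refine lintegral_congr fun x => ?_
  rw [← ofReal_norm, ← ENNReal.ofReal_pow (norm_nonneg _)]

/-- **Spectral interpolation `‖∇v‖₂⁴ ≤ ‖v‖₂² ‖Δv‖₂²`** (in `[0, ∞]`, for `v ∈ L²(T^d; ℝ^d)`):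
with `aₖ = |v̂ₖ|²` one has `‖∇v‖₂² = 4π² ∑|k|²aₖ`, `‖Δv‖₂² = 16π⁴ ∑|k|⁴aₖ`
(`Torus.eGradNormSq`, `Turb.eLaplacianNormSq`) and `‖v‖₂² = ∑ aₖ` (Parseval,
`Torus.tsum_enorm_sq_mFourierCoeff_complexify`), so this is the Cauchy–Schwarz inequality
`(∑|k|²aₖ)² ≤ (∑aₖ)(∑|k|⁴aₖ)` — the spatial half of Alexakis–Doering's "(trickI)"
`⟨ω²⟩² ≤ ⟨|u|²⟩⟨|∇ω|²⟩` ("integrations by parts and the Cauchy–Schwarz inequality",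
`‖∇v‖² = -(v, Δv) ≤ ‖v‖‖Δv‖`). [cite: AlexakisDoering2006PLA, §2 display (trickI)] -/
theorem eGradNormSq_sq_le_lintegral_mul_eLaplacianNormSq {v : UnitAddTorus d → EuclideanSpace ℝ d}
    (hv : MemLp v 2 volume) :
    Torus.eGradNormSq v ^ 2 ≤ (∫⁻ x, ‖v x‖ₑ ^ 2) * eLaplacianNormSq v := by
  set c := EuclideanSpace.complexify ∘ v with hc
  set a : (d → ℤ) → ℝ≥0∞ := fun k => ‖mFourierCoeff c k‖ₑ ^ 2 with ha
  set w : (d → ℤ) → ℝ≥0∞ := fun k => if k = 0 then 0 else ENNReal.ofReal (Torus.freqNormSq k)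
    with hw
  have hG : Torus.eGradNormSq v = ENNReal.ofReal (4 * Real.pi ^ 2) * ∑' k, w k * a k := by
    rw [Torus.eGradNormSq, eHomSobolevSeminorm_one_sq_eq_tsum]
  have hL : eLaplacianNormSq v = ENNReal.ofReal (16 * Real.pi ^ 4) * ∑' k, w k ^ 2 * a k := by
    rw [eLaplacianNormSq, eHomSobolevSeminorm_two_sq_eq_tsum]
  have hE : ∫⁻ x, ‖v x‖ₑ ^ 2 = ∑' k, a k :=
    (Torus.tsum_enorm_sq_mFourierCoeff_complexify hv).symm
  have hconst : ENNReal.ofReal (4 * Real.pi ^ 2) ^ 2 = ENNReal.ofReal (16 * Real.pi ^ 4) := by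
    rw [← ENNReal.ofReal_pow (by positivity)]
    congr 1
    ring
  rw [hG, hL, hE, mul_pow, hconst]
  calc ENNReal.ofReal (16 * Real.pi ^ 4) * (∑' k, w k * a k) ^ 2
      ≤ ENNReal.ofReal (16 * Real.pi ^ 4) * ((∑' k, a k) * ∑' k, w k ^ 2 * a k) := by
        gcongr
        exact sq_tsum_mul_le_tsum_mul_tsum w a
    _ = (∑' k, a k) * (ENNReal.ofReal (16 * Real.pi ^ 4) * ∑' k, w k ^ 2 * a k) := by ring

/-- Real form of the spectral interpolation: for `v ∈ L² ∩ H²` (i.e. `‖Δv‖₂² < ∞`),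
`(‖∇v‖₂²)² ≤ ‖v‖₂² · ‖Δv‖₂²` with the `toReal` renderings used by `Turb.meanDissipation` and
`Turb.meanEnstrophyDissipation`. [cite: AlexakisDoering2006PLA, §2 display (trickI)] -/
theorem toReal_eGradNormSq_sq_le {v : UnitAddTorus d → EuclideanSpace ℝ d}
    (hv : MemLp v 2 volume) (hfin : eLaplacianNormSq v ≠ ∞) :
    (Torus.eGradNormSq v).toReal ^ 2 ≤ (∫ x, ‖v x‖ ^ 2) * (eLaplacianNormSq v).toReal := by
  have h := eGradNormSq_sq_le_lintegral_mul_eLaplacianNormSq hv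
  rw [lintegral_enorm_sq_eq_ofReal hv] at h
  have hne : ENNReal.ofReal (∫ x, ‖v x‖ ^ 2) * eLaplacianNormSq v ≠ ∞ :=
    ENNReal.mul_ne_top ENNReal.ofReal_ne_top hfin
  have hG : Torus.eGradNormSq v ^ 2 ≠ ∞ := ne_top_of_le_ne_top hne h
  have h' := (ENNReal.toReal_le_toReal hG hne).mpr h
  rwa [ENNReal.toReal_pow, ENNReal.toReal_mul,
    ENNReal.toReal_ofReal (integral_nonneg fun _ => sq_nonneg _)] at h'

end Space

/-! ### Time: Cauchy–Schwarz for running means -/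

section Time

/-- Cauchy–Schwarz in time: if `0 ≤ G`, `G² ≤ E L` a.e. with `E, L ≥ 0` integrable and `G`
measurable, then `∫ G ≤ (∫ E · ∫ L)^{1/2}` (pointwise `G ≤ √E √L`, then Hölder with
`p = q = 2`, `integral_mul_le_Lp_mul_Lq_of_nonneg`). [folklore] -/
theorem integral_le_sqrt_integral_mul_integral {α : Type*} [MeasurableSpace α] {μ : Measure α}
    {G E L : α → ℝ} (hG0 : 0 ≤ᵐ[μ] G) (hE0 : 0 ≤ᵐ[μ] E) (hL0 : 0 ≤ᵐ[μ] L)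
    (hGEL : ∀ᵐ x ∂μ, G x ^ 2 ≤ E x * L x) (hG : AEStronglyMeasurable G μ)
    (hE : Integrable E μ) (hL : Integrable L μ) :
    ∫ x, G x ∂μ ≤ Real.sqrt ((∫ x, E x ∂μ) * ∫ x, L x ∂μ) := by
  -- pointwise `G ≤ √E · √L ≤ (E + L)/2`
  have hpt : ∀ᵐ x ∂μ, G x ≤ Real.sqrt (E x) * Real.sqrt (L x) := by
    filter_upwards [hG0, hE0, hGEL] with x hG0 hE0 hGEL
    rw [← Real.sqrt_mul hE0, ← Real.sqrt_sq hG0]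
    exact Real.sqrt_le_sqrt hGEL
  have hamgm : ∀ᵐ x ∂μ, Real.sqrt (E x) * Real.sqrt (L x) ≤ (E x + L x) / 2 := by
    filter_upwards [hE0, hL0] with x hEx hLx
    have h1 := two_mul_le_add_sq (Real.sqrt (E x)) (Real.sqrt (L x))
    rw [Real.sq_sqrt hEx, Real.sq_sqrt hLx] at h1
    linarith
  have hsEm : AEStronglyMeasurable (fun x => Real.sqrt (E x)) μ :=
    Real.continuous_sqrt.comp_aestronglyMeasurable hE.aestronglyMeasurable
  have hsLm : AEStronglyMeasurable (fun x => Real.sqrt (L x)) μ :=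
    Real.continuous_sqrt.comp_aestronglyMeasurable hL.aestronglyMeasurable
  have hsE : MemLp (fun x => Real.sqrt (E x)) 2 μ := by
    rw [memLp_two_iff_integrable_sq hsEm]
    refine hE.congr ?_
    filter_upwards [hE0] with x hx
    rw [Real.sq_sqrt hx]
  have hsL : MemLp (fun x => Real.sqrt (L x)) 2 μ := by
    rw [memLp_two_iff_integrable_sq hsLm]
    refine hL.congr ?_
    filter_upwards [hL0] with x hx
    rw [Real.sq_sqrt hx]
  -- integrability of `G` and of `√E √L` by domination with `(E + L)/2`
  have hdom : Integrable (fun x => (E x + L x) / 2) μ := (hE.add hL).div_const 2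
  have hGi : Integrable G μ := by
    refine hdom.mono' hG ?_
    filter_upwards [hpt, hG0, hamgm] with x hx hx0 hxm
    rw [Real.norm_of_nonneg hx0]
    exact hx.trans hxm
  have hPi : Integrable (fun x => Real.sqrt (E x) * Real.sqrt (L x)) μ := by
    refine hdom.mono' (hsEm.mul hsLm) ?_
    filter_upwards [hamgm] with x hxm
    rw [Real.norm_of_nonneg (mul_nonneg (Real.sqrt_nonneg _) (Real.sqrt_nonneg _))]
    exact hxm
  -- Hölder
  have h2 : ENNReal.ofReal (2 : ℝ) = 2 := by simp
  have hH := integral_mul_le_Lp_mul_Lq_of_nonneg (μ := μ) Real.HolderConjugate.two_two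
    (ae_of_all _ fun x => Real.sqrt_nonneg (E x)) (ae_of_all _ fun x => Real.sqrt_nonneg (L x))
    (by rw [h2]; exact hsE) (by rw [h2]; exact hsL)
  have hE2 : ∫ x, Real.sqrt (E x) ^ (2 : ℝ) ∂μ = ∫ x, E x ∂μ := by
    refine integral_congr_ae ?_
    filter_upwards [hE0] with x hx
    rw [Real.rpow_two, Real.sq_sqrt hx]
  have hL2 : ∫ x, Real.sqrt (L x) ^ (2 : ℝ) ∂μ = ∫ x, L x ∂μ := by
    refine integral_congr_ae ?_
    filter_upwards [hL0] with x hx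
    rw [Real.rpow_two, Real.sq_sqrt hx]
  rw [hE2, hL2] at hH
  have hEn : 0 ≤ ∫ x, E x ∂μ := integral_nonneg_of_ae hE0
  calc ∫ x, G x ∂μ ≤ ∫ x, Real.sqrt (E x) * Real.sqrt (L x) ∂μ := integral_mono_ae hGi hPi hpt
    _ ≤ (∫ x, E x ∂μ) ^ (1 / (2 : ℝ)) * (∫ x, L x ∂μ) ^ (1 / (2 : ℝ)) := hH
    _ = Real.sqrt ((∫ x, E x ∂μ) * ∫ x, L x ∂μ) := by
        rw [Real.sqrt_mul hEn, Real.sqrt_eq_rpow, Real.sqrt_eq_rpow]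

/-- **Cauchy–Schwarz for running time means** (the temporal half of Alexakis–Doering's
"(trickI)"): for `T > 0`, if on `(0, T]` one has `0 ≤ G`, `0 ≤ E`, `0 ≤ L`, `G² ≤ E L` a.e.,
`G` measurable and `E, L` integrable, then `T⁻¹∫₀ᵀ G ≤ (T⁻¹∫₀ᵀ E · T⁻¹∫₀ᵀ L)^{1/2}`
(`Turb.timeMean`). [cite: AlexakisDoering2006PLA, §2 display (trickI)] -/
theorem timeMean_le_sqrt_timeMean_mul_timeMean {G E L : ℝ → ℝ} {T : ℝ} (hT : 0 < T)
    (hG0 : ∀ᵐ t ∂(volume.restrict (Ioc 0 T)), 0 ≤ G t)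
    (hE0 : ∀ᵐ t ∂(volume.restrict (Ioc 0 T)), 0 ≤ E t)
    (hL0 : ∀ᵐ t ∂(volume.restrict (Ioc 0 T)), 0 ≤ L t)
    (hGEL : ∀ᵐ t ∂(volume.restrict (Ioc 0 T)), G t ^ 2 ≤ E t * L t)
    (hG : AEStronglyMeasurable G (volume.restrict (Ioc 0 T)))
    (hE : IntegrableOn E (Ioc 0 T)) (hL : IntegrableOn L (Ioc 0 T)) :
    timeMean G T ≤ Real.sqrt (timeMean E T * timeMean L T) := by
  unfold timeMean
  rw [intervalIntegral.integral_of_le hT.le, intervalIntegral.integral_of_le hT.le,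
    intervalIntegral.integral_of_le hT.le]
  have h := integral_le_sqrt_integral_mul_integral hG0 hE0 hL0 hGEL hG hE hL
  have hTinv : (0 : ℝ) ≤ T⁻¹ := by positivity
  calc T⁻¹ * ∫ t in Ioc 0 T, G t
      ≤ T⁻¹ * Real.sqrt ((∫ t in Ioc 0 T, E t) * ∫ t in Ioc 0 T, L t) :=
        mul_le_mul_of_nonneg_left h hTinv
    _ = Real.sqrt (T⁻¹ * (∫ t in Ioc 0 T, E t) * (T⁻¹ * ∫ t in Ioc 0 T, L t)) := by
        rw [show T⁻¹ * (∫ t in Ioc 0 T, E t) * (T⁻¹ * ∫ t in Ioc 0 T, L t) =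
            T⁻¹ ^ 2 * ((∫ t in Ioc 0 T, E t) * ∫ t in Ioc 0 T, L t) by ring,
          Real.sqrt_mul (sq_nonneg _), Real.sqrt_sq hTinv]

/-- Constants come out of running means: `T⁻¹∫₀ᵀ c·f = c · T⁻¹∫₀ᵀ f` (no integrability
needed). [folklore] -/
theorem timeMean_const_mul (c : ℝ) (f : ℝ → ℝ) (T : ℝ) :
    timeMean (fun t => c * f t) T = c * timeMean f T := by
  unfold timeMean
  rw [intervalIntegral.integral_const_mul]
  ring

end Time

/-! ### `limsup`: products of eventually bounded running means -/

section Limsup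

/-- A nonzero real `limsup` along `atTop` forces eventual boundedness from above: otherwise
`limsup g = sInf {a | ∀ᶠ T, g T ≤ a} = sInf ∅ = 0` (Mathlib's junk value). In particular the
hypothesis `0 < U = ⟨‖u‖₂²⟩^{1/2}` of the turbulence statements makes the running means of the
energy eventually bounded. [folklore] -/
theorem isBoundedUnder_of_limsup_ne_zero {g : ℝ → ℝ} (h : limsup g atTop ≠ 0) :
    IsBoundedUnder (· ≤ ·) atTop g := by
  by_contra hb
  apply h
  rw [Filter.limsup_eq]
  have hempty : {a : ℝ | ∀ᶠ n in atTop, g n ≤ a} = ∅ := by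
    ext a
    simp only [Set.mem_setOf_eq, Set.mem_empty_iff_false, iff_false]
    exact fun ha => hb ⟨a, ha⟩
  rw [hempty, Real.sInf_empty]

/-- `0 < U` makes `U` honest: if `rmsVelocity longTimeAvgSup u > 0` then the running means
`T⁻¹∫₀ᵀ ‖u(t)‖₂² dt` are eventually bounded above. [folklore] -/
theorem isBoundedUnder_timeMean_of_rmsVelocity_pos {d : Type*} [Fintype d]
    {u : ℝ → UnitAddTorus d → EuclideanSpace ℝ d} (hU : 0 < rmsVelocity longTimeAvgSup u) :
    IsBoundedUnder (· ≤ ·) atTop (timeMean fun t => ∫ x, ‖u t x‖ ^ 2) := by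
  refine isBoundedUnder_of_limsup_ne_zero fun h0 => ?_
  have : rmsVelocity longTimeAvgSup u = 0 := by
    rw [rmsVelocity, meanSqVelocity, longTimeAvgSup, h0, Real.sqrt_zero]
  exact hU.ne' this

/-- **Passing to `limsup` in `g ≤ (c e l)^{1/2}`**: for real functions on `atTop` with `g, e, l`
eventually nonnegative, `e` and `l` eventually bounded above and `g T ≤ (c · e T · l T)^{1/2}`
eventually (`c ≥ 0`), one has `limsup g ≤ (c · limsup e · limsup l)^{1/2}` (for every `δ > 0`,
eventually `e ≤ limsup e + δ` and `l ≤ limsup l + δ`; then let `δ → 0`). The boundedness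
hypotheses are necessary with Mathlib's real `limsup` (junk `0` for unbounded families). [folklore] -/
theorem limsup_le_sqrt_of_eventually_le {g e l : ℝ → ℝ} {c : ℝ} (hc : 0 ≤ c)
    (hg : ∀ᶠ T in atTop, 0 ≤ g T) (he : ∀ᶠ T in atTop, 0 ≤ e T) (hl : ∀ᶠ T in atTop, 0 ≤ l T)
    (heb : IsBoundedUnder (· ≤ ·) atTop e) (hlb : IsBoundedUnder (· ≤ ·) atTop l)
    (h : ∀ᶠ T in atTop, g T ≤ Real.sqrt (c * e T * l T)) :
    limsup g atTop ≤ Real.sqrt (c * limsup e atTop * limsup l atTop) := by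
  set E := limsup e atTop with hEdef
  set L := limsup l atTop with hLdef
  have hE0 : 0 ≤ E := limsup_nonneg_of_eventually_nonneg he
  have hL0 : 0 ≤ L := limsup_nonneg_of_eventually_nonneg hl
  -- for every `δ > 0`
  have hδ : ∀ δ : ℝ, 0 < δ → limsup g atTop ≤ Real.sqrt (c * (E + δ) * (L + δ)) := by
    intro δ hδ
    have heδ : ∀ᶠ T in atTop, e T < E + δ := eventually_lt_of_limsup_lt (by linarith) heb
    have hlδ : ∀ᶠ T in atTop, l T < L + δ := eventually_lt_of_limsup_lt (by linarith) hlb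
    refine limsup_le_of_le (isCoboundedUnder_le_of_eventually_le atTop hg) ?_
    filter_upwards [h, heδ, hlδ, he, hl] with T hT heT hlT he0 hl0
    refine hT.trans (Real.sqrt_le_sqrt ?_)
    have h1 : c * e T ≤ c * (E + δ) := mul_le_mul_of_nonneg_left heT.le hc
    calc c * e T * l T ≤ c * (E + δ) * l T := mul_le_mul_of_nonneg_right h1 hl0
      _ ≤ c * (E + δ) * (L + δ) :=
          mul_le_mul_of_nonneg_left hlT.le (mul_nonneg hc (by linarith))
  -- let `δ → 0⁺`
  have hcont : ContinuousAt (fun δ : ℝ => Real.sqrt (c * (E + δ) * (L + δ))) 0 :=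
    ((continuous_const.mul (continuous_const.add continuous_id)).mul
      (continuous_const.add continuous_id)).sqrt.continuousAt
  refine le_of_forall_pos_lt_add fun ε hε => ?_
  have hev : ∀ᶠ δ in 𝓝[>] (0 : ℝ), Real.sqrt (c * (E + δ) * (L + δ)) <
      Real.sqrt (c * (E + 0) * (L + 0)) + ε :=
    (hcont.tendsto.eventually (gt_mem_nhds (by linarith))).filter_mono nhdsWithin_le_nhds
  obtain ⟨δ, hδlt, hδpos⟩ := (hev.and self_mem_nhdsWithin).exists
  simp only [add_zero] at hδlt
  exact (hδ δ hδpos).trans_lt hδlt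

end Limsup

/-! ### Assembly: `ε² ≤ ν U² χ` under explicit regularity -/

section Assembly

variable {d : Type*} [Fintype d]

/-- **Alexakis–Doering's "(trickI)" `ε² ≤ ν U² χ` under explicit regularity**
(Alexakis–Doering, Phys. Lett. A 359 (2006), §2: `⟨ω²⟩² ≤ ⟨|u|²⟩⟨|∇ω|²⟩`). Let `ν ≥ 0` and
let `u : ℝ → T^d → ℝ^d` (any `d`) satisfy: `u(t) ∈ L²` and `‖Δu(t)‖₂² < ∞` for a.e. `t > 0`;
`t ↦ ‖∇u(t)‖₂²` is a.e.-strongly measurable on `(0, ∞)`; `t ↦ ‖u(t)‖₂²` and `t ↦ ‖Δu(t)‖₂²`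
are integrable on every `(0, T]`; and the running means `T⁻¹∫₀ᵀ‖u‖₂²`, `T⁻¹∫₀ᵀ‖Δu‖₂²` are
eventually bounded above. Then, with `ε = meanDissipation ν u`, `U = rmsVelocity longTimeAvgSup u`
and `χ = meanEnstrophyDissipation ν u` (spectral norms, `limsup` averages): `ε² ≤ ν U² χ`.
Proof: space (`toReal_eGradNormSq_sq_le`) + time (`timeMean_le_sqrt_timeMean_mul_timeMean`)
+ `limsup` (`limsup_le_sqrt_of_eventually_le`). [cite: AlexakisDoering2006PLA, §2 display (trickI)] -/
theorem meanDissipation_sq_le_of_regular {ν : ℝ} (hν : 0 ≤ ν)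
    {u : ℝ → UnitAddTorus d → EuclideanSpace ℝ d}
    (hL2 : ∀ᵐ t ∂(volume.restrict (Ioi 0)), MemLp (u t) 2 volume)
    (hH2 : ∀ᵐ t ∂(volume.restrict (Ioi 0)), eLaplacianNormSq (u t) ≠ ∞)
    (hGm : AEStronglyMeasurable (fun t => (Torus.eGradNormSq (u t)).toReal)
      (volume.restrict (Ioi 0)))
    (hEi : ∀ T, 0 < T → IntegrableOn (fun t => ∫ x, ‖u t x‖ ^ 2) (Ioc 0 T))
    (hLi : ∀ T, 0 < T → IntegrableOn (fun t => (eLaplacianNormSq (u t)).toReal) (Ioc 0 T))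
    (hEb : IsBoundedUnder (· ≤ ·) atTop (timeMean fun t => ∫ x, ‖u t x‖ ^ 2))
    (hLb : IsBoundedUnder (· ≤ ·) atTop (timeMean fun t => (eLaplacianNormSq (u t)).toReal)) :
    meanDissipation ν u ^ 2 ≤
      ν * rmsVelocity longTimeAvgSup u ^ 2 * meanEnstrophyDissipation ν u := by
  -- the three integrands and their running means
  set G : ℝ → ℝ := fun t => (Torus.eGradNormSq (u t)).toReal with hGdef
  set E : ℝ → ℝ := fun t => ∫ x, ‖u t x‖ ^ 2 with hEdef
  set L : ℝ → ℝ := fun t => (eLaplacianNormSq (u t)).toReal with hLdef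
  have hG0 : ∀ t, 0 ≤ G t := fun t => ENNReal.toReal_nonneg
  have hE0 : ∀ t, 0 ≤ E t := fun t => integral_nonneg fun _ => sq_nonneg _
  have hL0 : ∀ t, 0 ≤ L t := fun t => ENNReal.toReal_nonneg
  -- pointwise-in-time Cauchy–Schwarz for `T > 0`
  have hstep : ∀ T, 0 < T → timeMean G T ≤ Real.sqrt (timeMean E T * timeMean L T) := by
    intro T hT
    have hsub : Ioc (0 : ℝ) T ⊆ Ioi 0 := Ioc_subset_Ioi_self
    have hGEL : ∀ᵐ t ∂(volume.restrict (Ioc 0 T)), G t ^ 2 ≤ E t * L t := by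
      have h1 := ae_restrict_of_ae_restrict_of_subset hsub hL2
      have h2 := ae_restrict_of_ae_restrict_of_subset hsub hH2
      filter_upwards [h1, h2] with t ht1 ht2
      exact toReal_eGradNormSq_sq_le ht1 ht2
    exact timeMean_le_sqrt_timeMean_mul_timeMean hT (ae_of_all _ fun t => hG0 t)
      (ae_of_all _ fun t => hE0 t) (ae_of_all _ fun t => hL0 t) hGEL
      (hGm.mono_measure (Measure.restrict_mono hsub le_rfl)) (hEi T hT) (hLi T hT)
  -- the inequality between running means, with the viscosity put in
  have hev : ∀ᶠ T in atTop, timeMean (fun t => ν * G t) T ≤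
      Real.sqrt (ν * timeMean E T * timeMean (fun t => ν * L t) T) := by
    filter_upwards [eventually_gt_atTop (0 : ℝ)] with T hT
    rw [timeMean_const_mul, timeMean_const_mul]
    have hs : Real.sqrt (ν * timeMean E T * (ν * timeMean L T)) =
        ν * Real.sqrt (timeMean E T * timeMean L T) := by
      rw [show ν * timeMean E T * (ν * timeMean L T) = ν ^ 2 * (timeMean E T * timeMean L T)
        by ring, Real.sqrt_mul (sq_nonneg ν), Real.sqrt_sq hν]
    rw [hs]
    exact mul_le_mul_of_nonneg_left (hstep T hT) hν
  -- signs and bounds of the running means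
  have hg0 : ∀ᶠ T in atTop, 0 ≤ timeMean (fun t => ν * G t) T := by
    filter_upwards [eventually_ge_atTop (0 : ℝ)] with T hT
    exact timeMean_nonneg (fun t => mul_nonneg hν (hG0 t)) hT
  have he0 : ∀ᶠ T in atTop, 0 ≤ timeMean E T := by
    filter_upwards [eventually_ge_atTop (0 : ℝ)] with T hT
    exact timeMean_nonneg hE0 hT
  have hl0 : ∀ᶠ T in atTop, 0 ≤ timeMean (fun t => ν * L t) T := by
    filter_upwards [eventually_ge_atTop (0 : ℝ)] with T hT
    exact timeMean_nonneg (fun t => mul_nonneg hν (hL0 t)) hT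
  have hlb : IsBoundedUnder (· ≤ ·) atTop (timeMean fun t => ν * L t) := by
    obtain ⟨b, hb⟩ := hLb
    refine ⟨ν * b, ?_⟩
    rw [Filter.eventually_map] at hb ⊢
    filter_upwards [hb] with T hT
    rw [timeMean_const_mul]
    exact mul_le_mul_of_nonneg_left hT hν
  -- pass to `limsup`
  have hlim := limsup_le_sqrt_of_eventually_le hν hg0 he0 hl0 hEb hlb hev
  -- identify the three `limsup`s
  have hε : limsup (timeMean fun t => ν * G t) atTop = meanDissipation ν u := rfl
  have hU2 : limsup (timeMean E) atTop = rmsVelocity longTimeAvgSup u ^ 2 := by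
    rw [rmsVelocity, Real.sq_sqrt (meanEnergy_nonneg u)]
    rfl
  have hχ : limsup (timeMean fun t => ν * L t) atTop = meanEnstrophyDissipation ν u := rfl
  rw [hε, hU2, hχ] at hlim
  have hX : 0 ≤ ν * rmsVelocity longTimeAvgSup u ^ 2 * meanEnstrophyDissipation ν u :=
    mul_nonneg (mul_nonneg hν (sq_nonneg _))
      (longTimeAvgSup_nonneg fun t => mul_nonneg hν (hL0 t))
  calc meanDissipation ν u ^ 2
      ≤ Real.sqrt (ν * rmsVelocity longTimeAvgSup u ^ 2 * meanEnstrophyDissipation ν u) ^ 2 := by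
        gcongr
        · exact meanDissipation_nonneg hν u
    _ = ν * rmsVelocity longTimeAvgSup u ^ 2 * meanEnstrophyDissipation ν u := Real.sq_sqrt hX

end Assembly

end Literature.Analysis.FluidPDE

end
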